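import Mathlib
import HarnessLib

/-!
# Crux `EulerZoomLiouville.PowerGaugeEulerLiouville` (stmt-NavierStokesRegularity-19832), line `pressure-floor`, stub A2 — brick 1:
# THE SHELL-MEAN LEMMA AND THE PINCHING ALGEBRA for the Newtonian bump weights

Route №10 `EulerZoomLiouville` (NavierStokesRegularity), crux E.  Line `pressure-floor` (ideator ns-idea-11;
`Cruxes/PowerGaugeEulerLiouville/Lines/pressure_floor.lean`), registered stub `stub_newtonianBumps` (A2): existence of the Newtonian
bump family — radial weights `Ψ_R` with prescribed compactly supported Laplacian `w_β θ(|x|/R)`, PINCHED Hessian on `B_R` and tidal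
decay outside.  Writing `Ψ_R(x) = g(|x|²)` (the parametrisation in which smoothness across the origin is automatic, and in which the
tree's `RadialCalculus` gives `D²Ψ(z)(v,v) = 4g''(σ)⟨z,v⟩² + 2g'(σ)|v|²`, `σ = |z|²`), the radial Poisson equation `4σ g'' + 6 g' = ρ(σ)`
is solved by the SHELL MEAN `2g'(σ) = m(σ) := ∫₀¹ t² ρ(σt²) dt` (`= F(r)/r³`, `F(r) = ∫₀ʳ s²ρ(s²) ds`), and the Hessian becomes
`D²Ψ(v,v) = m |v|² + (ρ − 3m) ⟨ẑ, v⟩²`.  This file supplies the two scalar inequalities the pinching rests on: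

* `shellMean_lower`, `shellMean_upper` — for the profile `W(τ) = (1+τ)^{−β/2}`, `0 ≤ β < 3` (the line uses `β < 1`), and `σ ≥ 0`:
  `W(σ)/3 ≤ ∫₀¹ t² W(σt²) dt ≤ W(σ)/(3−β)` (lower: `W` is non-increasing; upper: `t ↦ t³W(σt²)/(3−β)` is a primitive dominating the
  integrand, since `(3−β)(1+σt²) ≤ 3 + (3−β)σt²`);
* `pinching_of_shellMean` — if `W/3 ≤ m ≤ W/(3−β)` (`β < 1`) and `0 ≤ c ≤ |v|²` then
  `((1−β)/(3−β)) W |v|² ≤ m|v|² + (W − 3m) c ≤ (1/(3−β)) W |v|²` — the interior pinching constants of the line card, with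
  `c = ⟨ẑ,v⟩²`.

Pure one-variable calculus (Mathlib only; no definitions).  The construction of `g` itself (parametric integral, smoothness,
`ΔΨ = ρ(|x|²)` via `Literature/Analysis/FluidPDE/RadialCalculus.laplacian_comp_norm_sq`, decay and tidal bounds) is the remaining part of A2.

WHAT THIS IS NOT: not NS, not the crux — a helper `--supports` stmt-19832 on the line `pressure-floor`; no summit statement is proved here.
[folklore]
-/

noncomputable section

-- flat `Theorems/<Route><Decl>…` files of one crux share the namespace of the crux (tree convention)
set_option linter.dupNamespace false

open MeasureTheory Set Filter Topology intervalIntegral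

namespace Summit.NavierStokesRegularity.NavierStokesRegularity.Theorems.PowerGaugeEulerLiouville.PressureFloor

/-! ### The shell mean of the profile `(1+τ)^{-β/2}` -/

/-- **Shell mean, lower bound**: for `β ≥ 0` and `σ ≥ 0`, `(1+σ)^{−β/2}/3 ≤ ∫₀¹ t² (1+σt²)^{−β/2} dt`
(the profile is non-increasing, so the integrand is at least `t²(1+σ)^{−β/2}`, and `∫₀¹ t² = 1/3`). [folklore] -/
theorem shellMean_lower {β σ : ℝ} (hβ : 0 ≤ β) (hσ : 0 ≤ σ) :
    (1 + σ) ^ (-(β / 2)) / 3 ≤ ∫ t in (0 : ℝ)..1, t ^ 2 * (1 + σ * t ^ 2) ^ (-(β / 2)) := by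
  have hbase : ∀ t : ℝ, 0 < 1 + σ * t ^ 2 := fun t => by
    have := mul_nonneg hσ (sq_nonneg t); linarith
  have hcont : Continuous fun t : ℝ => t ^ 2 * (1 + σ * t ^ 2) ^ (-(β / 2)) :=
    (continuous_pow 2).mul ((continuous_const.add (continuous_const.mul (continuous_pow 2))).rpow_const
      fun t => Or.inl (hbase t).ne')
  have hle : ∀ t ∈ Icc (0 : ℝ) 1, t ^ 2 * (1 + σ) ^ (-(β / 2)) ≤ t ^ 2 * (1 + σ * t ^ 2) ^ (-(β / 2)) := by
    intro t ht
    refine mul_le_mul_of_nonneg_left ?_ (sq_nonneg t)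
    have ht2 : t ^ 2 ≤ 1 := by nlinarith [ht.1, ht.2]
    exact Real.rpow_le_rpow_of_nonpos (hbase t) (by nlinarith) (by linarith)
  calc (1 + σ) ^ (-(β / 2)) / 3 = ∫ t in (0 : ℝ)..1, t ^ 2 * (1 + σ) ^ (-(β / 2)) := by
        rw [intervalIntegral.integral_mul_const, integral_pow]
        norm_num
        ring
    _ ≤ ∫ t in (0 : ℝ)..1, t ^ 2 * (1 + σ * t ^ 2) ^ (-(β / 2)) :=
        intervalIntegral.integral_mono_on zero_le_one
          (((continuous_pow 2).mul continuous_const).intervalIntegrable _ _) (hcont.intervalIntegrable _ _) hle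

/-- **Shell mean, upper bound**: for `0 ≤ β < 3` and `σ ≥ 0`, `∫₀¹ t² (1+σt²)^{−β/2} dt ≤ (1+σ)^{−β/2}/(3−β)`.
Proof: `H(t) = t³(1+σt²)^{−β/2}/(3−β)` has `H(0) = 0`, `H(1) = (1+σ)^{−β/2}/(3−β)` and
`H'(t) = t²(1+σt²)^{−β/2−1}(3 + (3−β)σt²)/(3−β) ≥ t²(1+σt²)^{−β/2}` because `(3−β)(1+σt²) ≤ 3 + (3−β)σt²`. [folklore] -/
theorem shellMean_upper {β σ : ℝ} (hβ : 0 ≤ β) (hβ3 : β < 3) (hσ : 0 ≤ σ) :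
    ∫ t in (0 : ℝ)..1, t ^ 2 * (1 + σ * t ^ 2) ^ (-(β / 2)) ≤ (1 + σ) ^ (-(β / 2)) / (3 - β) := by
  have h3β : 0 < 3 - β := by linarith
  set p : ℝ := -(β / 2) with hp
  -- the primitive `H` and its derivative
  set H : ℝ → ℝ := fun t => t ^ 3 * (1 + σ * t ^ 2) ^ p / (3 - β) with hH
  set H' : ℝ → ℝ := fun t => (3 * t ^ 2 * (1 + σ * t ^ 2) ^ p +
    t ^ 3 * (2 * σ * t * p * (1 + σ * t ^ 2) ^ (p - 1))) / (3 - β) with hH'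
  have hbase : ∀ t : ℝ, 0 < 1 + σ * t ^ 2 := fun t => by
    have := mul_nonneg hσ (sq_nonneg t); linarith
  have hderiv : ∀ t : ℝ, HasDerivAt H (H' t) t := by
    intro t
    have h1 : HasDerivAt (fun t : ℝ => 1 + σ * t ^ 2) (2 * σ * t) t := by
      have h := ((hasDerivAt_pow 2 t).const_mul σ).const_add 1
      refine h.congr_deriv ?_
      norm_num
      ring
    have h2 : HasDerivAt (fun t : ℝ => (1 + σ * t ^ 2) ^ p) (2 * σ * t * p * (1 + σ * t ^ 2) ^ (p - 1)) t :=
      h1.rpow_const (Or.inl (hbase t).ne')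
    have h3 : HasDerivAt (fun t : ℝ => t ^ 3 * (1 + σ * t ^ 2) ^ p)
        (3 * t ^ 2 * (1 + σ * t ^ 2) ^ p + t ^ 3 * (2 * σ * t * p * (1 + σ * t ^ 2) ^ (p - 1))) t := by
      have h := (hasDerivAt_pow 3 t).mul h2
      refine h.congr_deriv ?_
      norm_num
    have h4 := h3.div_const (3 - β)
    exact h4
  have hH'c : Continuous H' := by
    have hc1 : Continuous fun t : ℝ => (1 + σ * t ^ 2) ^ p :=
      (continuous_const.add (continuous_const.mul (continuous_pow 2))).rpow_const fun t => Or.inl (hbase t).ne'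
    have hc2 : Continuous fun t : ℝ => (1 + σ * t ^ 2) ^ (p - 1) :=
      (continuous_const.add (continuous_const.mul (continuous_pow 2))).rpow_const fun t => Or.inl (hbase t).ne'
    simp only [hH']
    fun_prop
  have hfc : Continuous fun t : ℝ => t ^ 2 * (1 + σ * t ^ 2) ^ p :=
    (continuous_pow 2).mul ((continuous_const.add (continuous_const.mul (continuous_pow 2))).rpow_const
      fun t => Or.inl (hbase t).ne')
  -- the integrand is dominated by `H'`
  have hle : ∀ t ∈ Icc (0 : ℝ) 1, t ^ 2 * (1 + σ * t ^ 2) ^ p ≤ H' t := by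
    intro t ht
    have hb := hbase t
    have hsplit : (1 + σ * t ^ 2) ^ p = (1 + σ * t ^ 2) ^ (p - 1) * (1 + σ * t ^ 2) := by
      rw [Real.rpow_sub_one hb.ne', div_mul_cancel₀ _ hb.ne']
    have hq : 0 ≤ (1 + σ * t ^ 2) ^ (p - 1) := Real.rpow_nonneg hb.le _
    simp only [hH']
    rw [le_div_iff₀ h3β, hsplit, hp]
    have ht0 : 0 ≤ t := ht.1
    -- `(3-β) t² q (1+σt²) ≤ 3 t² q (1+σt²) - β σ t⁴ q`, i.e. `0 ≤ β t² q`
    nlinarith [mul_nonneg (mul_nonneg hβ (sq_nonneg t)) hq, mul_nonneg hσ (sq_nonneg t)]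
  calc ∫ t in (0 : ℝ)..1, t ^ 2 * (1 + σ * t ^ 2) ^ p ≤ ∫ t in (0 : ℝ)..1, H' t :=
        intervalIntegral.integral_mono_on zero_le_one (hfc.intervalIntegrable _ _) (hH'c.intervalIntegrable _ _) hle
    _ = H 1 - H 0 := integral_eq_sub_of_hasDerivAt (fun t _ => hderiv t) (hH'c.intervalIntegrable _ _)
    _ = (1 + σ) ^ p / (3 - β) := by simp [hH]

/-- **Shell mean, two-sided**: `(1+σ)^{−β/2}/3 ≤ ∫₀¹ t²(1+σt²)^{−β/2} dt ≤ (1+σ)^{−β/2}/(3−β)` for `0 ≤ β < 1`, `σ ≥ 0` — the form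
consumed by the pinching step of the Newtonian bump family (`F(r)/(r³ w_β(r)) ∈ [1/3, 1/(3−β)]` with `σ = r²`). [folklore] -/
theorem shellMean_mem_Icc {β σ : ℝ} (hβ : 0 ≤ β) (hβ1 : β < 1) (hσ : 0 ≤ σ) :
    (∫ t in (0 : ℝ)..1, t ^ 2 * (1 + σ * t ^ 2) ^ (-(β / 2))) ∈
      Icc ((1 + σ) ^ (-(β / 2)) / 3) ((1 + σ) ^ (-(β / 2)) / (3 - β)) :=
  ⟨shellMean_lower hβ hσ, shellMean_upper hβ (by linarith) hσ⟩

/-! ### The pinching algebra -/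

/-- **Pinching of the radial Hessian from the shell-mean bounds.**  If `β < 1`, `W/3 ≤ m ≤ W/(3−β)` and `0 ≤ c ≤ |v|²`
(in the application `m = F/r³` is the shell mean, `W = w_β(r)` the density and `c = ⟨ẑ, v⟩²`), then the radial Hessian value
`m|v|² + (W − 3m)c` is pinched: `((1−β)/(3−β)) W|v|² ≤ m|v|² + (W − 3m)c ≤ (1/(3−β)) W|v|²` (since `W − 3m ≤ 0`: the minimum is at
`c = |v|²`, the maximum at `c = 0`). [folklore] -/
theorem pinching_of_shellMean {β W m c nv : ℝ} (hβ1 : β < 1)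
    (hm1 : W / 3 ≤ m) (hm2 : m ≤ W / (3 - β)) (hc0 : 0 ≤ c) (hc1 : c ≤ nv) :
    (1 - β) / (3 - β) * W * nv ≤ m * nv + (W - 3 * m) * c ∧ m * nv + (W - 3 * m) * c ≤ 1 / (3 - β) * W * nv := by
  have h3β : 0 < 3 - β := by linarith
  have hm2' : m * (3 - β) ≤ W := by rwa [le_div_iff₀ h3β] at hm2
  have hneg : W - 3 * m ≤ 0 := by linarith
  have hnv : 0 ≤ nv := hc0.trans hc1
  constructor
  · -- minimum at `c = nv`: value `(W - 2m) nv ≥ (W - 2W/(3-β)) nv = ((1-β)/(3-β)) W nv`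
    have h1 : m * nv + (W - 3 * m) * nv ≤ m * nv + (W - 3 * m) * c := by nlinarith
    have h2 : (1 - β) / (3 - β) * W * nv ≤ m * nv + (W - 3 * m) * nv := by
      have e : (1 - β) / (3 - β) * W = W - 2 * (W / (3 - β)) := by field_simp; ring
      rw [e]
      nlinarith
    exact h2.trans h1
  · -- maximum at `c = 0`: value `m nv ≤ W nv/(3-β)`
    have h1 : m * nv + (W - 3 * m) * c ≤ m * nv := by nlinarith
    have h2 : m * nv ≤ 1 / (3 - β) * W * nv := by
      rw [show 1 / (3 - β) * W = W / (3 - β) by ring]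
      exact mul_le_mul_of_nonneg_right hm2 hnv
    exact h1.trans h2

/-- **The pinching in vector form**: with `c = ⟨e, v⟩²` for a unit vector `e` one has `0 ≤ c ≤ |v|²` (Cauchy–Schwarz), so the
radial Hessian value `m|v|² + (W − 3m)⟨e,v⟩²` is pinched between `((1−β)/(3−β))W|v|²` and `W|v|²/(3−β)`. [folklore] -/
theorem pinching_of_shellMean_inner {β W m : ℝ} (hβ1 : β < 1)
    (hm1 : W / 3 ≤ m) (hm2 : m ≤ W / (3 - β)) {e v : EuclideanSpace ℝ (Fin 3)} (he : ‖e‖ = 1) :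
    (1 - β) / (3 - β) * W * ‖v‖ ^ 2 ≤ m * ‖v‖ ^ 2 + (W - 3 * m) * (inner ℝ e v) ^ 2 ∧
      m * ‖v‖ ^ 2 + (W - 3 * m) * (inner ℝ e v) ^ 2 ≤ 1 / (3 - β) * W * ‖v‖ ^ 2 := by
  have hcs : |inner ℝ e v| ≤ ‖v‖ := by
    have := abs_real_inner_le_norm e v
    rwa [he, one_mul] at this
  have hc1 : (inner ℝ e v) ^ 2 ≤ ‖v‖ ^ 2 := by
    have := sq_le_sq' (abs_le.1 hcs).1 (abs_le.1 hcs).2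
    simpa using this
  exact pinching_of_shellMean hβ1 hm1 hm2 (sq_nonneg _) hc1

end Summit.NavierStokesRegularity.NavierStokesRegularity.Theorems.PowerGaugeEulerLiouville.PressureFloor

end
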